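import Literature.Analysis.FluidPDE.NewtonKernelLogPotential
import HarnessLib

/-!
# Log-Lipschitz kernel-difference bounds for singular kernels of degree `-2` on `ℝ³`

Analysis/FluidPDE support file (theorems only, no definitions, no named facts) on the discharge
path of the named fact
`Literature.Analysis.FluidPDE.ShirotaYanagisawa1993_periodicCylinderLogDivCurlEstimate`
(`Ferrari1993LogEstimateReduction.lean`; Shirota–Yanagisawa 1993, (15) p. 80; Ferrari 1993,
Cor. 1 (31) p. 286: the logarithmic `W^{1,∞}` bound of a divergence-free field tangential on the
wall by the sup norm of its vorticity). The planned discharge (see the module docstring of the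
review, `NOTES.md` of unit `rsplit-…S-893994fbf1`) does **not** go through Green matrices: it
bounds the modulus of continuity of the velocity at scale `δ`,
`|v(x + h) − v(x)| ≲ ‖ω‖_∞ |h| (1 + log(R/|h|)) + …`, `|h| = δ`, from a whole-space Biot–Savart
identity for a Lipschitz, compactly supported field (the velocity reflected across the wall by
the inversion in the cylinder and cut off), and passes from difference quotients at scale `δ` to
the derivative by the `C^{1,1/2}` Morrey bound already in the tree
(`periodicCylinder_fderiv_holderHalf_norm_le`). The kernel-level input of that argument is the
classical *log-Lipschitz* computation (Yudovich; Majda–Bertozzi, *Vorticity and Incompressible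
Flow*, Lemma 8.1 and its proof: split `∫ |K(x − y) − K(z − y)| |f(y)| dy` at `|x − y| = 2|x − z|`),
which this file proves once and for all for the tree's singular kernels of degree `-2`
(`NewtonPotentialHolder.IsSingularKernel k 2 A B`: `|k(w)| ≤ A|w|⁻²` and
`|k(x − y) − k(z − y)| ≤ B|x − z||x − y|⁻³` for `|x − y| ≥ 2|x − z|`; e.g. `∂ⱼΓ`, and — uniformly in
the regularisation parameter — the regularised kernels `zⱼ/(4π(|z|² + ε²)^{3/2})` of the discharge):
with `d = |x − z| > 0` and `c₃ = 3|B₁|`,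

* `lintegral_enorm_kernel_sub_mul_le_log` — **bounded density** `|F| ≤ M` vanishing off
  `B(x, R)`, `2d ≤ R`: `∫ |k(x−y) − k(z−y)| |F(y)| dy ≤ M c₃ d (5A + B log(R/(2d)))`
  (near ball `B(x, 2d) ⊆ B(z, 3d)` by the size bound, annulus `2d ≤ |x−y| < R` by the regularity
  bound and `∫_{2d ≤ |x−y| < R} |x−y|⁻³ = c₃ log(R/(2d))`, `integral_annulus_norm_rpow_neg_three`);
* `lintegral_enorm_kernel_sub_mul_le_of_le_mul_norm` — **density vanishing linearly at `x`**,
  `|F(y)| ≤ Λ|x − y|` on `B(x, R)`, zero outside, `2d ≤ R`: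
  `∫ |k(x−y) − k(z−y)| |F(y)| dy ≤ Λ c₃ d (8Ad + BR)` (no logarithm: the extra factor `|x − y|`
  makes the annulus integral `∫ |x − y|⁻²` converge);
* `lintegral_enorm_kernel_sub_mul_le_far` — **density supported in the shell**
  `R/2 ≤ |x − y| < R`, `4d ≤ R`: `∫ |k(x−y) − k(z−y)| |F(y)| dy ≤ 8Bd R⁻³ ∫|F|`;
* the real-valued corollaries `abs_integral_kernel_sub_mul_le_log`, `…_of_le_mul_norm`,
  `…_far` (integrability included) for a.e.-strongly measurable `F`.

In the discharge the three densities are, respectively, the (reflected) vorticity cut off near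
`x` (bounded by the sup of `|curl v|`), the divergence defect of the reflected field (bounded by
`dist(y, wall) · sup ‖Dv‖ ≤ |x − y| sup ‖Dv‖`, absorbed for `R` small), and the cut-off terms
`∇χ × w`, `∇χ · w` (controlled by the local `L¹` norm of `v`, i.e. by the energy).

## Mathlib / tree search

Tree (used): `IsSingularKernel`, `lintegral_ball_enorm_kernel_rpow_le`,
`lintegral_ball_comp_sub_left`, `lintegral_ball_norm_rpow_neg` (`NewtonPotentialHolder`);
`lintegral_annulus_norm_rpow_neg_three` (`NewtonKernelLogPotential`; the logarithm, proved there
for Ferrari's (37)). `lean search 'log.?Lipschitz|kernel_sub_mul'`: no log-Lipschitz kernel bound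
in the tree (the Hölder-density form `IsHolderCZKernel.norm_czDiff_le_log` is a different
estimate: it needs a continuous density). Mathlib: `lintegral_add_compl`, `lintegral_indicator`,
`lintegral_sub_left_eq_self`, `enorm_integral_le_lintegral_enorm`.

## References

* A. J. Majda, A. L. Bertozzi, *Vorticity and Incompressible Flow*, CUP 2002, Lemma 8.1 and its
  proof (quasi-Lipschitz estimate for the Biot–Savart kernel: split at `2d`).
  [MajdaBertozziCUP2002]
* A. B. Ferrari, Comm. Math. Phys. 155 (1993) 277–294, proof of Prop. 1, (37) p. 287 (the
  logarithm of the annulus integral). [Ferrari1993]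
-/

noncomputable section

open MeasureTheory Set Function Filter Metric Real
open _root_.Topology
open scoped NNReal ENNReal

namespace Literature.Analysis.FluidPDE

namespace NewtonPotentialHolder

variable {k : (EuclideanSpace ℝ (Fin 3)) → ℝ} {A B : ℝ}

/-! ### Translated radial integrals -/

/-- Translation for annuli: `∫⁻_{B(x,R) \ B(x,r)} g(x - y) dy = ∫⁻_{B(0,R) \ B(0,r)} g(z) dz`.
[folklore] -/
theorem lintegral_annulus_comp_sub_left (g : (EuclideanSpace ℝ (Fin 3)) → ℝ≥0∞) (x : (EuclideanSpace ℝ (Fin 3))) (r R : ℝ) :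
    ∫⁻ y in ball x R \ ball x r, g (x - y) = ∫⁻ z in ball (0 : (EuclideanSpace ℝ (Fin 3))) R \ ball 0 r, g z := by
  have hS : MeasurableSet (ball x R \ ball x r) := measurableSet_ball.diff measurableSet_ball
  have hS0 : MeasurableSet (ball (0 : (EuclideanSpace ℝ (Fin 3))) R \ ball 0 r) := measurableSet_ball.diff measurableSet_ball
  rw [← lintegral_indicator hS, ← lintegral_indicator hS0,
    ← lintegral_sub_left_eq_self (fun z => (ball (0 : (EuclideanSpace ℝ (Fin 3))) R \ ball 0 r).indicator g z) x]
  congr 1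
  funext y
  have hmem : y ∈ ball x R \ ball x r ↔ x - y ∈ ball (0 : (EuclideanSpace ℝ (Fin 3))) R \ ball 0 r := by
    simp only [Set.mem_sdiff, mem_ball, dist_eq_norm, norm_sub_rev y x, sub_zero]
  by_cases hy : y ∈ ball x R \ ball x r
  · rw [indicator_of_mem hy, indicator_of_mem (hmem.1 hy)]
  · rw [indicator_of_notMem hy, indicator_of_notMem fun h => hy (hmem.2 h)]

/-- The logarithm about a general centre:
`∫⁻_{r ≤ |x−y| < R} |x − y|⁻³ dy = ENNReal.ofReal (3|B₁| log(R/r))` for `0 < r ≤ R`. [folklore] -/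
theorem lintegral_annulus_norm_sub_rpow_neg_three (x : (EuclideanSpace ℝ (Fin 3))) {r R : ℝ} (hr : 0 < r) (hrR : r ≤ R) :
    ∫⁻ y in ball x R \ ball x r, ENNReal.ofReal (‖x - y‖ ^ (-3 : ℝ)) =
      ENNReal.ofReal (3 * (volume : Measure (EuclideanSpace ℝ (Fin 3))).real (ball 0 1) * Real.log (R / r)) := by
  rw [lintegral_annulus_comp_sub_left (fun z => ENNReal.ofReal (‖z‖ ^ (-3 : ℝ))) x r R]
  exact lintegral_annulus_norm_rpow_neg_three hr hrR

/-- Radial power integral about a general centre: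
`∫⁻_{B(x,r)} |x − y|^{-s} dy = ENNReal.ofReal (3|B₁| r^{3-s}/(3-s))` for `s < 3`, `r > 0`.
[folklore] -/
theorem lintegral_ball_norm_sub_rpow_neg (x : (EuclideanSpace ℝ (Fin 3))) {s r : ℝ} (hs : s < 3) (hr : 0 < r) :
    ∫⁻ y in ball x r, ENNReal.ofReal (‖x - y‖ ^ (-s)) =
      ENNReal.ofReal (3 * (volume : Measure (EuclideanSpace ℝ (Fin 3))).real (ball 0 1) * (r ^ (3 - s) / (3 - s))) := by
  rw [lintegral_ball_comp_sub_left (fun z => ENNReal.ofReal (‖z‖ ^ (-s))) x r]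
  exact lintegral_ball_norm_rpow_neg hs hr

/-- Size bound on a ball about the centre, first power:
`∫⁻_{B(w,ρ)} |k(w − y)| dy ≤ ENNReal.ofReal (A · 3|B₁| · ρ)` for a singular kernel of degree `-2`.
[folklore] -/
theorem lintegral_ball_enorm_kernel_le (hk : IsSingularKernel k 2 A B) (hA : 0 ≤ A) (w : (EuclideanSpace ℝ (Fin 3)))
    {ρ : ℝ} (hρ : 0 < ρ) :
    ∫⁻ y in ball w ρ, ‖k (w - y)‖ₑ ≤
      ENNReal.ofReal (A * (3 * (volume : Measure (EuclideanSpace ℝ (Fin 3))).real (ball 0 1)) * ρ) := by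
  have h := lintegral_ball_enorm_kernel_rpow_le hk hA (q := 1) one_pos (by norm_num) w hρ
  simp only [ENNReal.rpow_one, Real.rpow_one] at h
  refine h.trans_eq ?_
  congr 1
  have e : (3 : ℝ) - 2 * 1 = 1 := by norm_num
  rw [e, Real.rpow_one, div_one]
  ring

/-! ### The three log-Lipschitz bounds in `ℝ≥0∞` form -/

/-- **Log-Lipschitz kernel bound, bounded density** (Majda–Bertozzi, proof of Lemma 8.1, in the
form needed for Yudovich's log-Lipschitz estimate): for a singular kernel `k` of degree `-2` with
constants `A, B`, a density `F` with `|F| ≤ M` vanishing off `B(x, R)`, and `z ≠ x` with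
`2|x − z| ≤ R`,
`∫ |k(x − y) − k(z − y)| |F(y)| dy ≤ M · 3|B₁| · |x − z| · (5A + B log(R/(2|x − z|)))`
(ball `|x − y| < 2d` by the size bound about `x` and about `z` — `B(x, 2d) ⊆ B(z, 3d)` —, annulus
`2d ≤ |x − y| < R` by the regularity bound and the logarithm). [cite: MajdaBertozziCUP2002, Lemma 8.1 (proof)] -/
theorem lintegral_enorm_kernel_sub_mul_le_log (hk : IsSingularKernel k 2 A B) (hA : 0 ≤ A)
    (hB : 0 ≤ B) {F : (EuclideanSpace ℝ (Fin 3)) → ℝ} {M R : ℝ} (hM : 0 ≤ M) (hFM : ∀ y, |F y| ≤ M) {x z : (EuclideanSpace ℝ (Fin 3))}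
    (hxz : x ≠ z) (hR : 2 * ‖x - z‖ ≤ R) (hFR : ∀ y, R ≤ ‖x - y‖ → F y = 0) :
    ∫⁻ y, ‖(k (x - y) - k (z - y)) * F y‖ₑ ≤
      ENNReal.ofReal (M * (3 * (volume : Measure (EuclideanSpace ℝ (Fin 3))).real (ball 0 1)) * ‖x - z‖ *
        (5 * A + B * Real.log (R / (2 * ‖x - z‖)))) := by
  have hd : 0 < ‖x - z‖ := norm_pos_iff.2 (sub_ne_zero.2 hxz)
  set d : ℝ := ‖x - z‖ with hdd
  set c₃ : ℝ := 3 * (volume : Measure (EuclideanSpace ℝ (Fin 3))).real (ball 0 1) with hc₃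
  have hc₃0 : 0 ≤ c₃ := three_mul_volume_real_ball_nonneg
  have hlog : 0 ≤ Real.log (R / (2 * d)) := Real.log_nonneg ((one_le_div (by positivity)).2 hR)
  set S : Set (EuclideanSpace ℝ (Fin 3)) := ball x (2 * d) with hS
  have hSm : MeasurableSet S := measurableSet_ball
  rw [← lintegral_add_compl (fun y => ‖(k (x - y) - k (z - y)) * F y‖ₑ) hSm]
  -- pointwise: `‖(k(x-y) - k(z-y)) F y‖ₑ ≤ (‖k(x-y)‖ₑ + ‖k(z-y)‖ₑ) * ofReal M`
  have hptM : ∀ y, ‖F y‖ₑ ≤ ENNReal.ofReal M := fun y => by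
    rw [← ofReal_norm, Real.norm_eq_abs]
    exact ENNReal.ofReal_le_ofReal (hFM y)
  -- near field
  have hnear : ∫⁻ y in S, ‖(k (x - y) - k (z - y)) * F y‖ₑ ≤
      ENNReal.ofReal (A * c₃ * (2 * d)) * ENNReal.ofReal M +
        ENNReal.ofReal (A * c₃ * (3 * d)) * ENNReal.ofReal M := by
    have hkm : ∀ w : (EuclideanSpace ℝ (Fin 3)), Measurable fun y => k (w - y) := fun w =>
      hk.measurable.comp (measurable_const.sub measurable_id)
    have h1 : ∫⁻ y in S, ‖(k (x - y) - k (z - y)) * F y‖ₑ ≤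
        ∫⁻ y in S, ‖k (x - y)‖ₑ * ENNReal.ofReal M + ‖k (z - y)‖ₑ * ENNReal.ofReal M := by
      refine lintegral_mono fun y => ?_
      rw [enorm_mul, ← add_mul]
      exact mul_le_mul' enorm_sub_le (hptM y)
    refine h1.trans ?_
    rw [lintegral_add_left' (((hkm x).enorm.mul_const _).aemeasurable),
      lintegral_mul_const' _ _ ENNReal.ofReal_ne_top, lintegral_mul_const' _ _ ENNReal.ofReal_ne_top]
    refine add_le_add ?_ ?_
    · gcongr
      exact lintegral_ball_enorm_kernel_le hk hA x (by positivity)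
    · gcongr ?_ * _
      have hsub : S ⊆ ball z (3 * d) := by
        intro y hy
        rw [hS, mem_ball] at hy
        rw [mem_ball]
        have hxz' : dist x z = d := by rw [hdd, dist_eq_norm]
        calc dist y z ≤ dist y x + dist x z := dist_triangle _ _ _
          _ < 2 * d + d := by linarith
          _ = 3 * d := by ring
      exact (lintegral_mono_set hsub).trans (lintegral_ball_enorm_kernel_le hk hA z (by positivity))
  -- far field
  have hfar : ∫⁻ y in Sᶜ, ‖(k (x - y) - k (z - y)) * F y‖ₑ ≤
      ENNReal.ofReal (B * d * M) * ENNReal.ofReal (c₃ * Real.log (R / (2 * d))) := by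
    set T : Set (EuclideanSpace ℝ (Fin 3)) := ball x R \ ball x (2 * d) with hT
    have hTm : MeasurableSet T := measurableSet_ball.diff measurableSet_ball
    have hpt : ∀ y ∈ Sᶜ, ‖(k (x - y) - k (z - y)) * F y‖ₑ ≤
        ENNReal.ofReal (B * d * M) * T.indicator (fun y => ENNReal.ofReal (‖x - y‖ ^ (-3 : ℝ))) y := by
      intro y hy
      have hy2 : 2 * d ≤ ‖x - y‖ := by
        rw [hS, mem_compl_iff, mem_ball, not_lt, dist_eq_norm, norm_sub_rev] at hy
        exact hy
      by_cases hyR : R ≤ ‖x - y‖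
      · rw [hFR y hyR, mul_zero, enorm_zero]
        exact zero_le
      · have hyT : y ∈ T := by
          rw [hT, Set.mem_sdiff, mem_ball, mem_ball, dist_eq_norm, norm_sub_rev, not_lt]
          exact ⟨not_le.1 hyR, hy2⟩
        rw [indicator_of_mem hyT, enorm_mul, ← ENNReal.ofReal_mul (by positivity)]
        have hkd : |k (x - y) - k (z - y)| ≤ B * d * ‖x - y‖ ^ (-3 : ℝ) := by
          have h := hk.abs_sub_le x z y hxz hy2
          have e : (-(2 + 1) : ℝ) = -3 := by norm_num
          rwa [e] at h
        calc ‖k (x - y) - k (z - y)‖ₑ * ‖F y‖ₑ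
            ≤ ENNReal.ofReal (B * d * ‖x - y‖ ^ (-3 : ℝ)) * ENNReal.ofReal M := by
              refine mul_le_mul' ?_ (hptM y)
              rw [← ofReal_norm, Real.norm_eq_abs]
              exact ENNReal.ofReal_le_ofReal hkd
          _ = ENNReal.ofReal (B * d * M * ‖x - y‖ ^ (-3 : ℝ)) := by
              rw [← ENNReal.ofReal_mul (by positivity)]
              ring_nf
    calc ∫⁻ y in Sᶜ, ‖(k (x - y) - k (z - y)) * F y‖ₑ
        ≤ ∫⁻ y in Sᶜ, ENNReal.ofReal (B * d * M) *
            T.indicator (fun y => ENNReal.ofReal (‖x - y‖ ^ (-3 : ℝ))) y :=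
          setLIntegral_mono' hSm.compl hpt
      _ ≤ ∫⁻ y, ENNReal.ofReal (B * d * M) *
            T.indicator (fun y => ENNReal.ofReal (‖x - y‖ ^ (-3 : ℝ))) y :=
          lintegral_mono' Measure.restrict_le_self le_rfl
      _ = ENNReal.ofReal (B * d * M) * ∫⁻ y in T, ENNReal.ofReal (‖x - y‖ ^ (-3 : ℝ)) := by
          rw [lintegral_const_mul' _ _ ENNReal.ofReal_ne_top, lintegral_indicator hTm]
      _ = ENNReal.ofReal (B * d * M) * ENNReal.ofReal (c₃ * Real.log (R / (2 * d))) := by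
          rw [hT, lintegral_annulus_norm_sub_rpow_neg_three x (by positivity) hR]
  refine (add_le_add hnear hfar).trans_eq ?_
  rw [← ENNReal.ofReal_mul (by positivity), ← ENNReal.ofReal_mul (by positivity),
    ← ENNReal.ofReal_mul (by positivity), ← ENNReal.ofReal_add (by positivity) (by positivity),
    ← ENNReal.ofReal_add (by positivity) (by positivity)]
  congr 1
  ring

/-- **Log-Lipschitz kernel bound, density vanishing linearly at the centre**: for a singular
kernel `k` of degree `-2` with constants `A, B`, a density with `|F(y)| ≤ Λ|x − y|` vanishing off
`B(x, R)`, and `z ≠ x` with `2|x − z| ≤ R`,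
`∫ |k(x − y) − k(z − y)| |F(y)| dy ≤ Λ · 3|B₁| · |x − z| · (8A|x − z| + BR)`
(ball `|x − y| < 2d`: `∫ |x−y|⁻¹` about `x` and `2d ∫ |z−y|⁻²` about `z`; annulus: `Bd ∫_{B(x,R)} |x−y|⁻²
= Bd · 3|B₁| R`). In the discharge `F` is the divergence defect of the reflected field and
`Λ ≲ sup ‖Dv‖`, so this term is absorbed for `R` small. [folklore] -/
theorem lintegral_enorm_kernel_sub_mul_le_of_le_mul_norm (hk : IsSingularKernel k 2 A B)
    (hA : 0 ≤ A) (hB : 0 ≤ B) {F : (EuclideanSpace ℝ (Fin 3)) → ℝ} {Λ R : ℝ} (hΛ : 0 ≤ Λ) {x z : (EuclideanSpace ℝ (Fin 3))}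
    (hFΛ : ∀ y, |F y| ≤ Λ * ‖x - y‖) (hxz : x ≠ z) (hR : 2 * ‖x - z‖ ≤ R)
    (hFR : ∀ y, R ≤ ‖x - y‖ → F y = 0) :
    ∫⁻ y, ‖(k (x - y) - k (z - y)) * F y‖ₑ ≤
      ENNReal.ofReal (Λ * (3 * (volume : Measure (EuclideanSpace ℝ (Fin 3))).real (ball 0 1)) * ‖x - z‖ *
        (8 * A * ‖x - z‖ + B * R)) := by
  have hd : 0 < ‖x - z‖ := norm_pos_iff.2 (sub_ne_zero.2 hxz)
  set d : ℝ := ‖x - z‖ with hdd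
  have hR0 : 0 < R := by linarith
  set c₃ : ℝ := 3 * (volume : Measure (EuclideanSpace ℝ (Fin 3))).real (ball 0 1) with hc₃
  have hc₃0 : 0 ≤ c₃ := three_mul_volume_real_ball_nonneg
  set S : Set (EuclideanSpace ℝ (Fin 3)) := ball x (2 * d) with hS
  have hSm : MeasurableSet S := measurableSet_ball
  rw [← lintegral_add_compl (fun y => ‖(k (x - y) - k (z - y)) * F y‖ₑ) hSm]
  have hptF : ∀ y, ‖F y‖ₑ ≤ ENNReal.ofReal (Λ * ‖x - y‖) := fun y => by
    rw [← ofReal_norm, Real.norm_eq_abs]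
    exact ENNReal.ofReal_le_ofReal (hFΛ y)
  -- pointwise near-field bounds
  have hpt1 : ∀ y, ‖k (x - y)‖ₑ * ‖F y‖ₑ ≤
      ENNReal.ofReal (Λ * A) * ENNReal.ofReal (‖x - y‖ ^ (-1 : ℝ)) := by
    intro y
    by_cases hy : x - y = 0
    · have : F y = 0 := by
        have h := hFΛ y
        rw [hy, norm_zero, mul_zero] at h
        exact abs_nonpos_iff.1 h
      rw [this, enorm_zero, mul_zero]
      exact zero_le
    have hny : 0 < ‖x - y‖ := norm_pos_iff.2 hy
    rw [← ENNReal.ofReal_mul (by positivity)]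
    calc ‖k (x - y)‖ₑ * ‖F y‖ₑ
        ≤ ENNReal.ofReal (A * ‖x - y‖ ^ (-2 : ℝ)) * ENNReal.ofReal (Λ * ‖x - y‖) := by
          refine mul_le_mul' ?_ (hptF y)
          rw [← ofReal_norm, Real.norm_eq_abs]
          exact ENNReal.ofReal_le_ofReal (hk.abs_le _)
      _ = ENNReal.ofReal (Λ * A * ‖x - y‖ ^ (-1 : ℝ)) := by
          rw [← ENNReal.ofReal_mul (by positivity)]
          congr 1
          have e : ‖x - y‖ ^ (-1 : ℝ) = ‖x - y‖ ^ (-2 : ℝ) * ‖x - y‖ := by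
            rw [← Real.rpow_add_one hny.ne']
            norm_num
          rw [e]
          ring
  have hpt2 : ∀ y ∈ S, ‖k (z - y)‖ₑ * ‖F y‖ₑ ≤ ‖k (z - y)‖ₑ * ENNReal.ofReal (Λ * (2 * d)) := by
    intro y hy
    refine mul_le_mul' le_rfl ((hptF y).trans (ENNReal.ofReal_le_ofReal ?_))
    have hy' : ‖x - y‖ < 2 * d := by
      rw [hS, mem_ball, dist_eq_norm, norm_sub_rev] at hy
      exact hy
    exact mul_le_mul_of_nonneg_left hy'.le hΛ
  have hsub : S ⊆ ball z (3 * d) := by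
    intro y hy
    rw [hS, mem_ball] at hy
    rw [mem_ball]
    have hxz' : dist x z = d := by rw [hdd, dist_eq_norm]
    calc dist y z ≤ dist y x + dist x z := dist_triangle _ _ _
      _ < 2 * d + d := by linarith
      _ = 3 * d := by ring
  have hkm : ∀ w : (EuclideanSpace ℝ (Fin 3)), Measurable fun y => k (w - y) := fun w =>
    hk.measurable.comp (measurable_const.sub measurable_id)
  -- near field
  have hnear : ∫⁻ y in S, ‖(k (x - y) - k (z - y)) * F y‖ₑ ≤
      ENNReal.ofReal (Λ * A) * ENNReal.ofReal (c₃ * ((2 * d) ^ (3 - 1 : ℝ) / (3 - 1))) +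
        ENNReal.ofReal (A * c₃ * (3 * d)) * ENNReal.ofReal (Λ * (2 * d)) := by
    have h1 : ∫⁻ y in S, ‖(k (x - y) - k (z - y)) * F y‖ₑ ≤
        ∫⁻ y in S, ENNReal.ofReal (Λ * A) * ENNReal.ofReal (‖x - y‖ ^ (-1 : ℝ)) +
          ‖k (z - y)‖ₑ * ENNReal.ofReal (Λ * (2 * d)) := by
      refine setLIntegral_mono' hSm fun y hy => ?_
      rw [enorm_mul]
      calc ‖k (x - y) - k (z - y)‖ₑ * ‖F y‖ₑ ≤ (‖k (x - y)‖ₑ + ‖k (z - y)‖ₑ) * ‖F y‖ₑ :=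
            mul_le_mul' enorm_sub_le le_rfl
        _ = ‖k (x - y)‖ₑ * ‖F y‖ₑ + ‖k (z - y)‖ₑ * ‖F y‖ₑ := add_mul _ _ _
        _ ≤ _ := add_le_add (hpt1 y) (hpt2 y hy)
    refine h1.trans ?_
    have hmeas : AEMeasurable (fun y => ENNReal.ofReal (Λ * A) * ENNReal.ofReal (‖x - y‖ ^ (-1 : ℝ)))
        (volume.restrict S) :=
      (((continuous_const.sub continuous_id).norm.measurable.pow_const _).ennreal_ofReal.const_mul
        _).aemeasurable
    rw [lintegral_add_left' hmeas, lintegral_const_mul' _ _ ENNReal.ofReal_ne_top,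
      lintegral_mul_const' _ _ ENNReal.ofReal_ne_top]
    refine add_le_add ?_ ?_
    · rw [hS, lintegral_ball_norm_sub_rpow_neg x (by norm_num) (by positivity)]
    · gcongr ?_ * _
      exact (lintegral_mono_set hsub).trans (lintegral_ball_enorm_kernel_le hk hA z (by positivity))
  -- far field: `B d |x-y|⁻³ · Λ|x-y| = BdΛ |x-y|⁻²` on the annulus, integrated over `B(x,R)`
  have hfar : ∫⁻ y in Sᶜ, ‖(k (x - y) - k (z - y)) * F y‖ₑ ≤
      ENNReal.ofReal (B * d * Λ) * ENNReal.ofReal (c₃ * (R ^ (3 - 2 : ℝ) / (3 - 2))) := by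
    set T : Set (EuclideanSpace ℝ (Fin 3)) := ball x R with hT
    have hTm : MeasurableSet T := measurableSet_ball
    have hpt : ∀ y ∈ Sᶜ, ‖(k (x - y) - k (z - y)) * F y‖ₑ ≤
        ENNReal.ofReal (B * d * Λ) * T.indicator (fun y => ENNReal.ofReal (‖x - y‖ ^ (-2 : ℝ))) y := by
      intro y hy
      have hy2 : 2 * d ≤ ‖x - y‖ := by
        rw [hS, mem_compl_iff, mem_ball, not_lt, dist_eq_norm, norm_sub_rev] at hy
        exact hy
      have hny : 0 < ‖x - y‖ := by linarith
      by_cases hyR : R ≤ ‖x - y‖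
      · rw [hFR y hyR, mul_zero, enorm_zero]
        exact zero_le
      · have hyT : y ∈ T := by
          rw [hT, mem_ball, dist_eq_norm, norm_sub_rev]
          exact not_le.1 hyR
        rw [indicator_of_mem hyT, enorm_mul, ← ENNReal.ofReal_mul (by positivity)]
        have hkd : |k (x - y) - k (z - y)| ≤ B * d * ‖x - y‖ ^ (-3 : ℝ) := by
          have h := hk.abs_sub_le x z y hxz hy2
          have e : (-(2 + 1) : ℝ) = -3 := by norm_num
          rwa [e] at h
        calc ‖k (x - y) - k (z - y)‖ₑ * ‖F y‖ₑ
            ≤ ENNReal.ofReal (B * d * ‖x - y‖ ^ (-3 : ℝ)) * ENNReal.ofReal (Λ * ‖x - y‖) := by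
              refine mul_le_mul' ?_ (hptF y)
              rw [← ofReal_norm, Real.norm_eq_abs]
              exact ENNReal.ofReal_le_ofReal hkd
          _ = ENNReal.ofReal (B * d * Λ * ‖x - y‖ ^ (-2 : ℝ)) := by
              rw [← ENNReal.ofReal_mul (by positivity)]
              congr 1
              have e : ‖x - y‖ ^ (-2 : ℝ) = ‖x - y‖ ^ (-3 : ℝ) * ‖x - y‖ := by
                rw [← Real.rpow_add_one hny.ne']
                norm_num
              rw [e]
              ring
    calc ∫⁻ y in Sᶜ, ‖(k (x - y) - k (z - y)) * F y‖ₑ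
        ≤ ∫⁻ y in Sᶜ, ENNReal.ofReal (B * d * Λ) *
            T.indicator (fun y => ENNReal.ofReal (‖x - y‖ ^ (-2 : ℝ))) y :=
          setLIntegral_mono' hSm.compl hpt
      _ ≤ ∫⁻ y, ENNReal.ofReal (B * d * Λ) *
            T.indicator (fun y => ENNReal.ofReal (‖x - y‖ ^ (-2 : ℝ))) y :=
          lintegral_mono' Measure.restrict_le_self le_rfl
      _ = ENNReal.ofReal (B * d * Λ) * ∫⁻ y in T, ENNReal.ofReal (‖x - y‖ ^ (-2 : ℝ)) := by
          rw [lintegral_const_mul' _ _ ENNReal.ofReal_ne_top, lintegral_indicator hTm]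
      _ = ENNReal.ofReal (B * d * Λ) * ENNReal.ofReal (c₃ * (R ^ (3 - 2 : ℝ) / (3 - 2))) := by
          rw [hT, lintegral_ball_norm_sub_rpow_neg x (by norm_num) hR0]
  refine (add_le_add hnear hfar).trans_eq ?_
  have e1 : (2 * d) ^ (3 - 1 : ℝ) / (3 - 1) = 2 * d ^ 2 := by
    have : (3 - 1 : ℝ) = 2 := by norm_num
    rw [this, Real.rpow_two]
    ring
  have e2 : R ^ (3 - 2 : ℝ) / (3 - 2) = R := by
    have : (3 - 2 : ℝ) = 1 := by norm_num
    rw [this, Real.rpow_one, div_one]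
  rw [e1, e2, ← ENNReal.ofReal_mul (by positivity), ← ENNReal.ofReal_mul (by positivity),
    ← ENNReal.ofReal_mul (by positivity), ← ENNReal.ofReal_add (by positivity) (by positivity),
    ← ENNReal.ofReal_add (by positivity) (by positivity)]
  congr 1
  ring

/-- **Log-Lipschitz kernel bound, far density**: for a singular kernel `k` of degree `-2` with
regularity constant `B`, a density `F` vanishing on `B(x, R/2)` and off `B(x, R)`, and `z ≠ x` with
`4|x − z| ≤ R`, `∫ |k(x − y) − k(z − y)| |F(y)| dy ≤ 8B|x − z| R⁻³ ∫ |F|` (on the support,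
`|x − y| ≥ R/2 ≥ 2|x − z|` and `|x − y|⁻³ ≤ 8R⁻³`). In the discharge `F` collects the cut-off terms
`∇χ × w`, `∇χ · w`. [folklore] -/
theorem lintegral_enorm_kernel_sub_mul_le_far (hk : IsSingularKernel k 2 A B) (hB : 0 ≤ B)
    {F : (EuclideanSpace ℝ (Fin 3)) → ℝ} {R : ℝ} {x z : (EuclideanSpace ℝ (Fin 3))} (hxz : x ≠ z) (hR : 4 * ‖x - z‖ ≤ R)
    (hFn : ∀ y, ‖x - y‖ < R / 2 → F y = 0) (hFR : ∀ y, R ≤ ‖x - y‖ → F y = 0) :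
    ∫⁻ y, ‖(k (x - y) - k (z - y)) * F y‖ₑ ≤
      ENNReal.ofReal (8 * B * ‖x - z‖ / R ^ 3) * ∫⁻ y, ‖F y‖ₑ := by
  have hd : 0 < ‖x - z‖ := norm_pos_iff.2 (sub_ne_zero.2 hxz)
  set d : ℝ := ‖x - z‖ with hdd
  have hR0 : 0 < R := by linarith
  rw [← lintegral_const_mul' _ _ ENNReal.ofReal_ne_top]
  refine lintegral_mono fun y => ?_
  by_cases hyn : ‖x - y‖ < R / 2
  · rw [hFn y hyn, mul_zero, enorm_zero]
    exact zero_le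
  by_cases hyR : R ≤ ‖x - y‖
  · rw [hFR y hyR, mul_zero, enorm_zero, mul_zero]
  rw [not_lt] at hyn
  have hy2 : 2 * d ≤ ‖x - y‖ := by linarith
  have hny : 0 < ‖x - y‖ := by linarith
  rw [enorm_mul]
  refine mul_le_mul' ?_ le_rfl
  rw [← ofReal_norm, Real.norm_eq_abs]
  refine ENNReal.ofReal_le_ofReal ?_
  have hkd : |k (x - y) - k (z - y)| ≤ B * d * ‖x - y‖ ^ (-3 : ℝ) := by
    have h := hk.abs_sub_le x z y hxz hy2
    have e : (-(2 + 1) : ℝ) = -3 := by norm_num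
    rwa [e] at h
  refine hkd.trans ?_
  have h3 : ‖x - y‖ ^ (-3 : ℝ) ≤ (R / 2) ^ (-3 : ℝ) :=
    Real.rpow_le_rpow_of_nonpos (by positivity) hyn (by norm_num)
  have e : (R / 2) ^ (-3 : ℝ) = 8 / R ^ 3 := by
    rw [Real.rpow_neg (by positivity), div_rpow hR0.le (by norm_num)]
    have : (3 : ℝ) = ((3 : ℕ) : ℝ) := by norm_num
    rw [this, Real.rpow_natCast, Real.rpow_natCast]
    field_simp
    norm_num
  calc B * d * ‖x - y‖ ^ (-3 : ℝ) ≤ B * d * (R / 2) ^ (-3 : ℝ) := by gcongr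
    _ = 8 * B * d / R ^ 3 := by rw [e]; ring

/-! ### Real-valued corollaries -/

/-- From an `ℝ≥0∞` bound on `∫⁻ ‖g‖ₑ` to integrability and a bound on `|∫ g|`. [folklore] -/
theorem abs_integral_le_of_lintegral_enorm_le {g : (EuclideanSpace ℝ (Fin 3)) → ℝ} (hg : AEStronglyMeasurable g volume)
    {b : ℝ} (hb : 0 ≤ b) (h : ∫⁻ y, ‖g y‖ₑ ≤ ENNReal.ofReal b) :
    Integrable g volume ∧ |∫ y, g y| ≤ b := by
  have hfin : HasFiniteIntegral g volume := by
    rw [hasFiniteIntegral_iff_enorm]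
    exact h.trans_lt ENNReal.ofReal_lt_top
  refine ⟨⟨hg, hfin⟩, ?_⟩
  rw [← Real.norm_eq_abs]
  have h1 := enorm_integral_le_lintegral_enorm (μ := (volume : Measure (EuclideanSpace ℝ (Fin 3)))) g
  have h2 : ‖∫ y, g y‖ₑ ≤ ENNReal.ofReal b := h1.trans h
  rwa [← ofReal_norm, ENNReal.ofReal_le_ofReal_iff hb] at h2

/-- Measurability of the kernel-difference integrand. [folklore] -/
theorem aestronglyMeasurable_kernel_sub_mul (hk : IsSingularKernel k 2 A B) {F : (EuclideanSpace ℝ (Fin 3)) → ℝ}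
    (hF : AEStronglyMeasurable F volume) (x z : (EuclideanSpace ℝ (Fin 3))) :
    AEStronglyMeasurable (fun y => (k (x - y) - k (z - y)) * F y) volume := by
  have hkm : ∀ w : (EuclideanSpace ℝ (Fin 3)), Measurable fun y => k (w - y) := fun w =>
    hk.measurable.comp (measurable_const.sub measurable_id)
  exact (((hkm x).sub (hkm z)).aestronglyMeasurable).mul hF

/-- Real form of `lintegral_enorm_kernel_sub_mul_le_log`: the kernel-difference integral of a
bounded density vanishing off `B(x, R)` converges and
`|∫ (k(x − y) − k(z − y)) F(y) dy| ≤ M · 3|B₁| · |x − z| · (5A + B log(R/(2|x − z|)))`.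
[cite: MajdaBertozziCUP2002, Lemma 8.1 (proof)] -/
theorem abs_integral_kernel_sub_mul_le_log (hk : IsSingularKernel k 2 A B) (hA : 0 ≤ A)
    (hB : 0 ≤ B) {F : (EuclideanSpace ℝ (Fin 3)) → ℝ} (hF : AEStronglyMeasurable F volume) {M R : ℝ} (hM : 0 ≤ M)
    (hFM : ∀ y, |F y| ≤ M) {x z : (EuclideanSpace ℝ (Fin 3))} (hxz : x ≠ z) (hR : 2 * ‖x - z‖ ≤ R)
    (hFR : ∀ y, R ≤ ‖x - y‖ → F y = 0) :
    Integrable (fun y => (k (x - y) - k (z - y)) * F y) volume ∧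
      |∫ y, (k (x - y) - k (z - y)) * F y| ≤
        M * (3 * (volume : Measure (EuclideanSpace ℝ (Fin 3))).real (ball 0 1)) * ‖x - z‖ *
          (5 * A + B * Real.log (R / (2 * ‖x - z‖))) := by
  have hd : 0 < ‖x - z‖ := norm_pos_iff.2 (sub_ne_zero.2 hxz)
  have hlog : 0 ≤ Real.log (R / (2 * ‖x - z‖)) :=
    Real.log_nonneg ((one_le_div (by positivity)).2 hR)
  exact abs_integral_le_of_lintegral_enorm_le (aestronglyMeasurable_kernel_sub_mul hk hF x z)
    (by have := three_mul_volume_real_ball_nonneg; positivity)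
    (lintegral_enorm_kernel_sub_mul_le_log hk hA hB hM hFM hxz hR hFR)

/-- Real form of `lintegral_enorm_kernel_sub_mul_le_of_le_mul_norm`:
`|∫ (k(x − y) − k(z − y)) F(y) dy| ≤ Λ · 3|B₁| · |x − z| · (8A|x − z| + BR)` for a density with
`|F(y)| ≤ Λ|x − y|` vanishing off `B(x, R)`, `2|x − z| ≤ R`. [folklore] -/
theorem abs_integral_kernel_sub_mul_le_of_le_mul_norm (hk : IsSingularKernel k 2 A B) (hA : 0 ≤ A)
    (hB : 0 ≤ B) {F : (EuclideanSpace ℝ (Fin 3)) → ℝ} (hF : AEStronglyMeasurable F volume) {Λ R : ℝ} (hΛ : 0 ≤ Λ)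
    {x z : (EuclideanSpace ℝ (Fin 3))} (hFΛ : ∀ y, |F y| ≤ Λ * ‖x - y‖) (hxz : x ≠ z) (hR : 2 * ‖x - z‖ ≤ R)
    (hFR : ∀ y, R ≤ ‖x - y‖ → F y = 0) :
    Integrable (fun y => (k (x - y) - k (z - y)) * F y) volume ∧
      |∫ y, (k (x - y) - k (z - y)) * F y| ≤
        Λ * (3 * (volume : Measure (EuclideanSpace ℝ (Fin 3))).real (ball 0 1)) * ‖x - z‖ * (8 * A * ‖x - z‖ + B * R) := by
  have hd : 0 < ‖x - z‖ := norm_pos_iff.2 (sub_ne_zero.2 hxz)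
  have hR0 : 0 < R := by linarith
  exact abs_integral_le_of_lintegral_enorm_le (aestronglyMeasurable_kernel_sub_mul hk hF x z)
    (by have := three_mul_volume_real_ball_nonneg; positivity)
    (lintegral_enorm_kernel_sub_mul_le_of_le_mul_norm hk hA hB hΛ hFΛ hxz hR hFR)

/-- Real form of `lintegral_enorm_kernel_sub_mul_le_far`:
`|∫ (k(x − y) − k(z − y)) F(y) dy| ≤ 8B|x − z| R⁻³ ∫ |F|` for an integrable density vanishing on
`B(x, R/2)` and off `B(x, R)`, `4|x − z| ≤ R`. [folklore] -/
theorem abs_integral_kernel_sub_mul_le_far (hk : IsSingularKernel k 2 A B) (hB : 0 ≤ B)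
    {F : (EuclideanSpace ℝ (Fin 3)) → ℝ} (hF : Integrable F volume) {R : ℝ} {x z : (EuclideanSpace ℝ (Fin 3))} (hxz : x ≠ z)
    (hR : 4 * ‖x - z‖ ≤ R) (hFn : ∀ y, ‖x - y‖ < R / 2 → F y = 0)
    (hFR : ∀ y, R ≤ ‖x - y‖ → F y = 0) :
    Integrable (fun y => (k (x - y) - k (z - y)) * F y) volume ∧
      |∫ y, (k (x - y) - k (z - y)) * F y| ≤ 8 * B * ‖x - z‖ / R ^ 3 * ∫ y, |F y| := by
  have hd : 0 < ‖x - z‖ := norm_pos_iff.2 (sub_ne_zero.2 hxz)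
  have hR0 : 0 < R := by linarith
  have hI : ∫⁻ y, ‖F y‖ₑ = ENNReal.ofReal (∫ y, |F y|) := by
    rw [← ofReal_integral_norm_eq_lintegral_enorm hF]
    simp only [Real.norm_eq_abs]
  have h := lintegral_enorm_kernel_sub_mul_le_far hk hB hxz hR hFn hFR
  rw [hI, ← ENNReal.ofReal_mul (by positivity)] at h
  have h0 : 0 ≤ ∫ y, |F y| := integral_nonneg fun y => abs_nonneg _
  exact abs_integral_le_of_lintegral_enorm_le (aestronglyMeasurable_kernel_sub_mul hk hF.1 x z)
    (by positivity) h

end NewtonPotentialHolder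

end Literature.Analysis.FluidPDE
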